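import Literature.Computability.AlgebraicComplexity.TableauEvalClosedForm
import Literature.Computability.AlgebraicComplexity.TableauEvalRowPeel
import Literature.Computability.AlgebraicComplexity.TableauEvalLabelWalk
import HarnessLib

/-!
# The label-major specification computes `evalC`

Lean checker of the GCT multiplicity-obstruction engine (cell `pub-gct`; honest framing: rung-1
multiplicity-obstruction search for permanent versus determinant at small `(n, m)`, no claim about
VP ≠ VNP or P ≠ NP). Correctness of the label-major organisation (`TableauEvalLabelWalk.lean`) of
the evaluation of a tableau highest-weight vector: for a list point `P` all of whose terms have `m`
forms and a COLUMN-STRICT network `N` passing the structural conditions (alternator and label lists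
of equal length, labels `< d`, every label on `m` boxes, variables `< N_v`), and any entry function
`S` that agrees with `α! · coeff_α` on words of length `m` with letters `< N_v`,

  `specL S [0, …, d-1] N.cols = evalC P N`   (`specL_eq_evalC`).

Route: §1 the closed form `TT col U` (a sum over tuples of column bijections of sign × the product
over the labels `U` of `S`-factors of the contents — `evalC` is `TT` at `U = [0, …, d-1]` by
`evalC_eq_sum_S`); §2 the outcomes of the walk of one label as a sum over choice tuples
(`sum_walkL`); §3 the one-label step of the closed form (`TT_cons`, from `multiPeel`); §4 the
invariants of residual column lists and the induction `specL_eq_TT`; §5 assembly. Elementary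
[folklore].
-/

noncomputable section

open scoped BigOperators

namespace Literature.Computability.AlgebraicComplexity

namespace TableauEval

open MvPolynomial Equiv

variable {σ : Type*} {K : Type*} [CommRing K]
variable {Nv : ℕ} (E : Enum σ Nv)

/-! ## §1 The closed form over residual columns -/

/-- The content a column with labels `labels` and variables-in-row-order `pv` gives to label `u`
(`colContent E c π u = colContentL E c.labels (permVars c π) u` by definition). [folklore] -/
def colContentL (labels pv : List ℕ) (u : ℕ) : σ →₀ ℕ :=
  (List.zipWith (fun u' i => if u = u' then Finsupp.single (E.x i) 1 else 0) labels pv).sum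

/-- `colContent` is `colContentL` of the labels and the variables in row order. [folklore] -/
theorem colContent_eq_colContentL (c : Column) (π : Perm (Fin c.vars.length)) (u : ℕ) :
    colContent E c π u = colContentL E c.labels (permVars c π) u := rfl

section Closed

variable [Fintype σ]

/-- **The closed form on a tuple of (residual) columns and a list of labels**:
`∑_π (∏_i sign π_i) · ∏_{u ∈ U} S(∑_i colContent_i(π_i, u))` with `S = Sfun E P m`. [folklore] -/
def TT (P : Point K) (m : ℕ) (C : ℕ) (col : Fin C → Column) (U : List ℕ) : K :=
  ∑ π : (i : Fin C) → Perm (Fin (col i).vars.length),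
    (∏ i, ((Perm.sign (π i) : ℤ) : K)) *
      (U.map fun u => Sfun E P m (∑ i, colContentL E (col i).labels (permVars (col i) (π i)) u)).prod

/-- Reindexing the columns along a cast of `Fin`. [folklore] -/
theorem TT_congr (P : Point K) (m : ℕ) {C C' : ℕ} (h : C' = C) (col : Fin C → Column) (U : List ℕ) :
    TT E P m C' (col ∘ Fin.cast h) U = TT E P m C col U := by
  subst h; rfl

end Closed

/-! ## §2 The outcomes of one walk as a sum over choice tuples -/

section Walk

variable {R : Type*} [CommRing R]

/-- The sign of a choice, in the ring: `(-1)^j` at an active column, `1` otherwise. [folklore] -/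
def epsK (R : Type*) [CommRing R] (b : Bool) (j : ℕ) : R := ((epsB b j : ℤ) : R)

/-- `epsK` at an active column. [folklore] -/
@[simp] theorem epsK_true (j : ℕ) : epsK R true j = (-1) ^ j := by
  simp [epsK, epsB]

/-- `epsK` at an inactive column. [folklore] -/
@[simp] theorem epsK_false (j : ℕ) : epsK R false j = 1 := by simp [epsK, epsB]

/-- The sign of the parity of `j` is `(-1)^j`. [folklore] -/
theorem sgn_decide_mod_two (j : ℕ) : (sgn (decide (j % 2 = 1)) : R) = (-1) ^ j := by
  rw [neg_one_pow_eq_pow_mod_two (R := R)]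
  rcases Nat.mod_two_eq_zero_or_one j with h | h <;> simp [sgn, h]

/-- A sum over `List.range n` as a sum over `Fin n`. [folklore] -/
theorem sum_map_range {M : Type*} [AddCommMonoid M] (n : ℕ) (g : ℕ → M) :
    ((List.range n).map g).sum = ∑ j : Fin n, g j := by
  induction n with
  | zero => simp
  | succ n ih => rw [List.range_succ, List.map_append, List.sum_append, ih, Fin.sum_univ_castSucc]; simp

/-- The word of a choice tuple: the variables given to the top boxes of the active columns, in
column order. [folklore] -/
def wordB {C : ℕ} (col : Fin C → Column) (act : Fin C → Bool) (js : Fin C → ℕ) : List ℕ :=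
  (List.ofFn fun i => preB (act i) (col i) (js i)).flatten

/-- **The walk of one label as a sum over choice tuples.** For residual columns `cs` whose
activity pattern at `u` is `act`, summing any `φ (sign, word, residual columns)` over the outcomes
of `walkL u cs` is summing, over the choice tuples `js`, `φ` at (`∏ epsK`, `wordB`, the list of the
residual columns `redB`). [folklore] -/
theorem sum_walkL (u : ℕ) {M : Type*} [AddCommMonoid M] :
    ∀ (cs : List Column) (act : Fin cs.length → Bool) (_ : ∀ i, (cs.get i).active u = act i)
      (φ : R → List ℕ → List Column → M),
    ((walkL u cs).map fun t => φ (sgn t.1) t.2.1 t.2.2).sum =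
      ∑ js : (i : Fin cs.length) → Fin (nchB (act i) (cs.get i)),
        φ (∏ i, epsK R (act i) (js i)) (wordB cs.get act (fun i => js i))
          (List.ofFn fun i => redB (act i) (cs.get i) (js i))
  | [], act, _, φ => by
    haveI : IsEmpty (Fin ([] : List Column).length) := (inferInstance : IsEmpty (Fin 0))
    rw [Fintype.sum_unique]
    simp [walkL, wordB, sgn]
  | c :: cs, act, hact, φ => by
    obtain ⟨b, t, rfl⟩ : ∃ b t, act = Fin.cons b t :=
      ⟨act 0, fun i => act i.succ, by funext i; refine Fin.cases ?_ (fun k => ?_) i <;> simp⟩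
    have hb : c.active u = b := hact 0
    have IH := sum_walkL u cs t (fun i => hact i.succ) (M := M)
    refine Eq.trans ?_ (sum_pi_fin_succ (fun i => Fin (nchB ((Fin.cons b t : Fin (cs.length + 1) →
      Bool) i) ((c :: cs).get i))) _).symm
    rw [walkL, hb]
    cases b with
    | false =>
      simp only [Bool.false_eq_true, ↓reduceIte, List.map_map]
      refine Eq.trans ?_ (Fin.sum_univ_one _).symm
      refine Eq.trans (IH (fun s w cs' => φ s w (c :: cs'))) (Finset.sum_congr rfl fun jst _ => ?_)
      congr 1
      · refine Eq.trans ?_ (Fin.prod_univ_succ _).symm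
        simp
      · unfold wordB; rw [List.ofFn_succ]; rfl
      · rw [List.ofFn_succ]; rfl
    | true =>
      simp only [↓reduceIte, sum_map_flatMap, List.map_map]
      rw [sum_map_range]
      refine Finset.sum_congr rfl fun j _ => ?_
      have e1 : ((walkL u cs).map ((fun t : Bool × List ℕ × List Column => φ (sgn t.1) t.2.1 t.2.2) ∘
          fun t => (xor (decide ((j : ℕ) % 2 = 1)) t.1, c.vars.getD j 0 :: t.2.1,
            c.reduce j :: t.2.2))).sum =
          ((walkL u cs).map fun t => (fun s w cs' => φ ((-1) ^ (j : ℕ) * s) (c.vars.getD j 0 :: w)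
            (c.reduce j :: cs')) (sgn t.1) t.2.1 t.2.2).sum :=
        congrArg List.sum (List.map_congr_left fun t _ => by
          simp only [Function.comp_apply, sgn_xor, sgn_decide_mod_two])
      rw [e1, IH (fun s w cs' => φ ((-1) ^ (j : ℕ) * s) (c.vars.getD j 0 :: w)
        (c.reduce j :: cs'))]
      refine Finset.sum_congr rfl fun jst _ => ?_
      congr 1
      · refine Eq.trans ?_ (Fin.prod_univ_succ _).symm
        simp
      · unfold wordB; rw [List.ofFn_succ]; rfl
      · rw [List.ofFn_succ]; rfl

end Walk

/-! ## §3 The one-label step of the closed form -/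

section Step

variable [Fintype σ]

omit [Fintype σ] in
/-- `colContentL` of a cons: the top box's label and variable split off. [folklore] -/
theorem colContentL_cons (l v : ℕ) (labels pv : List ℕ) (u : ℕ) :
    colContentL E (l :: labels) (v :: pv) u =
      (if u = l then Finsupp.single (E.x v) 1 else 0) + colContentL E labels pv u := by
  simp [colContentL]

omit [Fintype σ] in
/-- A label absent from a column contributes nothing. [folklore] -/
theorem colContentL_eq_zero_of_not_mem : ∀ (labels pv : List ℕ) (u : ℕ), u ∉ labels →
    colContentL E labels pv u = 0
  | [], pv, u, _ => by cases pv <;> simp [colContentL]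
  | l :: labels, [], u, _ => by simp [colContentL]
  | l :: labels, v :: pv, u, h => by
    have h1 : u ≠ l := fun e => h (by subst e; exact List.mem_cons_self)
    have h2 : u ∉ labels := fun e => h (List.mem_cons_of_mem _ e)
    rw [colContentL_cons, if_neg h1, colContentL_eq_zero_of_not_mem labels pv u h2, add_zero]

omit [Fintype σ] in
/-- An active column: its labels are `u :: tail`. [folklore] -/
theorem labels_eq_cons_of_active {c : Column} {u : ℕ} (h : c.active u = true) :
    c.labels = u :: c.labels.tail := by
  unfold Column.active at h
  cases hl : c.labels with
  | nil => simp [hl] at h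
  | cons l ls => simp [hl] at h; simp [h]

omit [Fintype σ] in
/-- The content a column gives to the label `u` being peeled: the chosen variable at an active
column (provided `u` is not among its remaining labels), nothing at an inactive column not
containing `u`. [folklore] -/
theorem colContentL_peel_self (c : Column) (u : ℕ) (b : Bool) (hb : c.active u = b)
    (hu : u ∉ (redB b c 0).labels) (j : ℕ) (pv : List ℕ) :
    colContentL E c.labels (preB b c j ++ pv) u = contentL E (preB b c j) := by
  cases b with
  | false =>
    simp only [preB, List.nil_append, contentL, List.map_nil, List.sum_nil]
    exact colContentL_eq_zero_of_not_mem E _ _ _ (by simpa [redB] using hu)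
  | true =>
    rw [labels_eq_cons_of_active (c := c) hb]
    simp only [preB, List.singleton_append, colContentL_cons, if_true, contentL, List.map_cons,
      List.map_nil, List.sum_cons, List.sum_nil, add_zero]
    rw [colContentL_eq_zero_of_not_mem E _ _ _ (by simpa [redB, Column.peel] using hu), add_zero]

omit [Fintype σ] in
/-- The content a column gives to a LATER label `u' ≠ u`: that of the residual column. [folklore] -/
theorem colContentL_peel_other (c : Column) (u u' : ℕ) (hne : u' ≠ u) (b : Bool)
    (hb : c.active u = b) (j : ℕ) (pv : List ℕ) :
    colContentL E c.labels (preB b c j ++ pv) u' = colContentL E (redB b c j).labels pv u' := by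
  cases b with
  | false => simp [preB, redB]
  | true =>
    rw [labels_eq_cons_of_active (c := c) hb]
    simp only [preB, List.singleton_append, colContentL_cons, if_neg hne, zero_add, redB,
      Column.peel]

/-- **The one-label step of the closed form.** For columns `col` with activity pattern `act` at
`u` (active columns having a variable), `u` not among the residual labels and not in `U'`,
`TT col (u :: U') = ∑_js (∏ epsK) · S(content of the chosen variables) · TT (residual cols) U'`.
[folklore] -/
theorem TT_cons (P : Point K) (m : ℕ) {C : ℕ} (col : Fin C → Column) (u : ℕ) (U' : List ℕ)
    (act : Fin C → Bool) (hact : ∀ i, (col i).active u = act i)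
    (hne : ∀ i, act i = true → (col i).vars ≠ [])
    (hres : ∀ i j, u ∉ (redB (act i) (col i) j).labels) (hU' : u ∉ U') :
    TT E P m C col (u :: U') =
      ∑ js : (i : Fin C) → Fin (nchB (act i) (col i)),
        (∏ i, epsK K (act i) (js i)) *
          Sfun E P m (∑ i, contentL E (preB (act i) (col i) (js i))) *
            TT E P m C (fun i => redB (act i) (col i) (js i)) U' := by
  unfold TT
  rw [multiPeel C col act hne (fun s w => (∏ i, ((s i : ℤ) : K)) *
    ((u :: U').map fun u'' => Sfun E P m (∑ i, colContentL E (col i).labels (w i) u'')).prod)]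
  refine Finset.sum_congr rfl fun js _ => ?_
  rw [Finset.mul_sum]
  refine Finset.sum_congr rfl fun π' _ => ?_
  beta_reduce
  -- signs
  have hsign : (∏ i, ((epsB (act i) (js i) * (Perm.sign (π' i) : ℤ) : ℤ) : K)) =
      (∏ i, epsK K (act i) (js i)) * ∏ i, ((Perm.sign (π' i) : ℤ) : K) := by
    rw [← Finset.prod_mul_distrib]
    refine Finset.prod_congr rfl fun i _ => ?_
    rw [Int.cast_mul, epsK]
  -- contents at the peeled label
  have hself : (∑ i, colContentL E (col i).labels (preB (act i) (col i) (js i) ++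
      permVars (redB (act i) (col i) (js i)) (π' i)) u) =
      ∑ i, contentL E (preB (act i) (col i) (js i)) := by
    refine Finset.sum_congr rfl fun i _ => ?_
    have hres0 : u ∉ (redB (act i) (col i) 0).labels := hres i 0
    exact colContentL_peel_self E (col i) u (act i) (hact i) hres0 _ _
  -- contents at the later labels
  have hother : ∀ u'' ∈ U', (∑ i, colContentL E (col i).labels (preB (act i) (col i) (js i) ++
      permVars (redB (act i) (col i) (js i)) (π' i)) u'') =
      ∑ i, colContentL E (redB (act i) (col i) (js i)).labels
        (permVars (redB (act i) (col i) (js i)) (π' i)) u'' := by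
    intro u'' hu''
    refine Finset.sum_congr rfl fun i _ => ?_
    exact colContentL_peel_other E (col i) u u'' (fun h => hU' (h ▸ hu'')) (act i) (hact i) _ _
  have hmap : (U'.map fun u'' => Sfun E P m (∑ i, colContentL E (col i).labels
      (preB (act i) (col i) (js i) ++ permVars (redB (act i) (col i) (js i)) (π' i)) u'')).prod =
      (U'.map fun u'' => Sfun E P m (∑ i, colContentL E (redB (act i) (col i) (js i)).labels
        (permVars (redB (act i) (col i) (js i)) (π' i)) u'')).prod := by
    congr 1
    exact List.map_congr_left fun u'' hu'' => by rw [hother u'' hu'']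
  rw [List.map_cons, List.prod_cons, hsign, hself, hmap]
  ring

end Step

/-! ## §4 Invariants of residual column lists and the induction -/

section Induction

variable [Fintype σ]

omit [Fintype σ] in
/-- `strictAsc` lists are pairwise `<`. [folklore] -/
theorem pairwise_of_strictAsc : ∀ l : List ℕ, strictAsc l = true → l.Pairwise (· < ·)
  | [], _ => List.Pairwise.nil
  | [a], _ => List.pairwise_singleton _ _
  | a :: b :: l, h => by
    simp only [strictAsc, Bool.and_eq_true, decide_eq_true_eq] at h
    have ht := pairwise_of_strictAsc (b :: l) h.2
    refine List.Pairwise.cons ?_ ht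
    intro x hx
    rcases List.mem_cons.mp hx with rfl | hx
    · exact h.1
    · exact lt_trans h.1 (List.rel_of_pairwise_cons ht hx)

/-- The invariants of a (list of labels still to process, list of residual columns) pair along
the label-major recursion. [folklore] -/
structure Inv (m Nv : ℕ) (U : List ℕ) (cs : List Column) : Prop where
  /-- as many unused variables as remaining boxes -/
  len : ∀ c ∈ cs, c.vars.length = c.labels.length
  /-- labels strictly increasing down every column -/
  asc : ∀ c ∈ cs, c.labels.Pairwise (· < ·)
  /-- every remaining label is still to be processed -/
  sub : ∀ c ∈ cs, ∀ l ∈ c.labels, l ∈ U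
  /-- labels are processed in increasing order -/
  uasc : U.Pairwise (· < ·)
  /-- variables are `< Nv` -/
  var : ∀ c ∈ cs, ∀ v ∈ c.vars, v < Nv
  /-- every label still to be processed sits on `m` boxes -/
  cnt : ∀ u ∈ U, countNat u (cs.flatMap Column.labels) = m

omit [Fintype σ] in
/-- In the invariant regime a column is active at the head label iff it contains it. [folklore] -/
theorem active_iff_mem {u : ℕ} {U' : List ℕ} (hU : (u :: U').Pairwise (· < ·)) (c : Column)
    (hasc : c.labels.Pairwise (· < ·)) (hsub : ∀ l ∈ c.labels, l ∈ u :: U') :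
    c.active u = true ↔ u ∈ c.labels := by
  constructor
  · intro h; rw [labels_eq_cons_of_active (c := c) h]; exact List.mem_cons_self
  · intro hu
    unfold Column.active
    cases hl : c.labels with
    | nil => simp [hl] at hu
    | cons l ls =>
      rw [hl] at hu hasc hsub
      rcases List.mem_cons.mp hu with rfl | hu'
      · simp
      · exfalso
        have h1 : l < u := List.rel_of_pairwise_cons hasc hu'
        rcases List.mem_cons.mp (hsub l List.mem_cons_self) with rfl | hl'
        · exact lt_irrefl _ h1
        · exact lt_asymm h1 (List.rel_of_pairwise_cons hU hl')

omit [Fintype σ] in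
/-- The head label is not among the labels of any residual column. [folklore] -/
theorem not_mem_redB {u : ℕ} {U' : List ℕ} (hU : (u :: U').Pairwise (· < ·)) (c : Column)
    (hasc : c.labels.Pairwise (· < ·)) (hsub : ∀ l ∈ c.labels, l ∈ u :: U') (b : Bool)
    (hb : c.active u = b) (j : ℕ) : u ∉ (redB b c j).labels := by
  cases b with
  | false =>
    intro hu
    have hu' : u ∈ c.labels := by simpa [redB] using hu
    have := (active_iff_mem hU c hasc hsub).mpr hu'
    rw [hb] at this; exact Bool.false_ne_true this
  | true =>
    intro hu
    have hu' : u ∈ c.labels.tail := by simpa [redB, Column.peel] using hu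
    rw [labels_eq_cons_of_active (c := c) hb] at hasc
    exact lt_irrefl _ (List.rel_of_pairwise_cons hasc hu')

omit [Fintype σ] in
/-- Lengths of a residual column (invariant regime). [folklore] -/
theorem length_redB (c : Column) (u : ℕ) (b : Bool) (hb : c.active u = b)
    (hl : c.vars.length = c.labels.length) (j : ℕ) (hj : j < nchB b c) :
    (redB b c j).vars.length = (redB b c j).labels.length := by
  cases b with
  | false => simpa [redB] using hl
  | true =>
    simp only [nchB] at hj
    simp only [redB, Column.peel, List.length_tail]
    rw [List.length_eraseIdx, if_pos hj, hl]

omit [Fintype σ] in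
/-- Labels of a residual column stay strictly increasing. [folklore] -/
theorem pairwise_redB (c : Column) (b : Bool) (ha : c.labels.Pairwise (· < ·)) (j : ℕ) :
    (redB b c j).labels.Pairwise (· < ·) := by
  cases b with
  | false => simpa [redB] using ha
  | true => simpa [redB, Column.peel] using ha.tail

omit [Fintype σ] in
/-- Labels of a residual column are labels of the column. [folklore] -/
theorem mem_labels_of_mem_redB (c : Column) (b : Bool) (j l : ℕ) (hl : l ∈ (redB b c j).labels) :
    l ∈ c.labels := by
  cases b with
  | false => simpa [redB] using hl
  | true => exact List.mem_of_mem_tail (by simpa [redB, Column.peel] using hl)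

omit [Fintype σ] in
/-- Variables of a residual column are variables of the column. [folklore] -/
theorem mem_vars_of_mem_redB (c : Column) (b : Bool) (j v : ℕ) (hv : v ∈ (redB b c j).vars) :
    v ∈ c.vars := by
  cases b with
  | false => simpa [redB] using hv
  | true => exact List.mem_of_mem_eraseIdx (by simpa [redB, Column.peel] using hv)

omit [Fintype σ] in
/-- `countNat` over a `flatMap` is the sum over the columns. [folklore] -/
theorem countNat_flatMap (u : ℕ) : ∀ cs : List Column,
    countNat u (cs.flatMap Column.labels) = (cs.map fun c => countNat u c.labels).sum
  | [] => by simp [countNat]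
  | c :: cs => by
    rw [List.flatMap_cons, List.map_cons, List.sum_cons, ← countNat_flatMap u cs]
    simp [countNat, List.filter_append]

omit [Fintype σ] in
/-- `countNat` over a `flatMap`, as a sum over column indices. [folklore] -/
theorem countNat_flatMap_get (u : ℕ) (cs : List Column) :
    countNat u (cs.flatMap Column.labels) = ∑ i : Fin cs.length, countNat u (cs.get i).labels := by
  rw [countNat_flatMap, sum_map_eq_sum_get]

omit [Fintype σ] in
/-- `countNat` over the `flatMap` of an `ofFn` list. [folklore] -/
theorem countNat_flatMap_ofFn (u : ℕ) {C : ℕ} (g : Fin C → Column) :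
    countNat u ((List.ofFn g).flatMap Column.labels) = ∑ i, countNat u (g i).labels := by
  rw [countNat_flatMap, List.map_ofFn, List.sum_ofFn]
  rfl

omit [Fintype σ] in
/-- A column's count of the head label: `1` if active, `0` if not (invariant regime). [folklore] -/
theorem countNat_labels_eq {u : ℕ} {U' : List ℕ} (hU : (u :: U').Pairwise (· < ·)) (c : Column)
    (hasc : c.labels.Pairwise (· < ·)) (hsub : ∀ l ∈ c.labels, l ∈ u :: U') (b : Bool)
    (hb : c.active u = b) : countNat u c.labels = if b then 1 else 0 := by
  have hres := not_mem_redB hU c hasc hsub b hb 0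
  cases b with
  | false =>
    simp only [redB] at hres
    simp only [countNat, Bool.false_eq_true, ↓reduceIte, List.length_eq_zero_iff,
      List.filter_eq_nil_iff, decide_eq_true_eq]
    intro l hl hlu; exact hres (hlu ▸ hl)
  | true =>
    rw [labels_eq_cons_of_active (c := c) hb]
    simp only [redB, Column.peel] at hres
    rw [labels_eq_cons_of_active (c := c) hb, List.tail_cons] at hres
    simp only [countNat, List.filter_cons, decide_true, ↓reduceIte, List.length_cons]
    have : (c.labels.tail.filter fun v => v = u) = [] := by
      rw [List.filter_eq_nil_iff]; intro l hl hlu; simp at hlu; exact hres (hlu ▸ hl)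
    rw [this]; rfl

omit [Fintype σ] in
/-- A residual column's count of a later label is unchanged. [folklore] -/
theorem countNat_redB {u u' : ℕ} (hne : u' ≠ u) (c : Column) (b : Bool) (hb : c.active u = b)
    (j : ℕ) : countNat u' (redB b c j).labels = countNat u' c.labels := by
  cases b with
  | false => rfl
  | true =>
    conv_rhs => rw [labels_eq_cons_of_active (c := c) hb]
    simp [redB, Column.peel, countNat, Ne.symm hne]

omit [Fintype σ] in
/-- Length of the word of a choice tuple: the number of active columns. [folklore] -/
theorem length_wordB {C : ℕ} (col : Fin C → Column) (act : Fin C → Bool) (js : Fin C → ℕ) :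
    (wordB col act js).length = ∑ i, if act i then 1 else 0 := by
  unfold wordB
  rw [List.length_flatten, List.map_ofFn, List.sum_ofFn]
  refine Finset.sum_congr rfl fun i _ => ?_
  simp only [Function.comp_apply]
  cases act i <;> simp [preB]

omit [Fintype σ] in
/-- Content of the word of a choice tuple: the sum of the contents of its pieces. [folklore] -/
theorem contentL_wordB {C : ℕ} (col : Fin C → Column) (act : Fin C → Bool) (js : Fin C → ℕ) :
    contentL E (wordB col act js) = ∑ i, contentL E (preB (act i) (col i) (js i)) := by
  unfold wordB contentL
  rw [List.map_flatten, List.sum_flatten, List.map_map, List.map_ofFn, List.sum_ofFn]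
  rfl

omit [Fintype σ] in
/-- Letters of the word of a choice tuple are variables of the columns. [folklore] -/
theorem mem_wordB {C : ℕ} (col : Fin C → Column) (act : Fin C → Bool)
    (js : (i : Fin C) → Fin (nchB (act i) (col i))) (v : ℕ)
    (hv : v ∈ wordB col act (fun i => (js i : ℕ))) : ∃ i, v ∈ (col i).vars := by
  unfold wordB at hv
  rw [List.mem_flatten] at hv
  obtain ⟨l, hl, hvl⟩ := hv
  rw [List.mem_ofFn] at hl
  obtain ⟨i, rfl⟩ := hl
  refine ⟨i, ?_⟩
  revert hvl
  generalize hb : act i = b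
  intro hvl
  cases b with
  | false => simp [preB] at hvl
  | true =>
    simp only [preB, List.mem_singleton] at hvl
    subst hvl
    have hj : ((js i : ℕ)) < (col i).vars.length := by
      have := (js i).isLt; simp only [hb, nchB] at this; exact this
    rw [List.getD_eq_getElem _ _ hj]
    exact List.getElem_mem hj

/-- `TT` of columns without boxes is `1`. [folklore] -/
theorem TT_nil_of_empty (P : Point K) (m : ℕ) {C : ℕ} (col : Fin C → Column)
    (h : ∀ i, (col i).vars = []) : TT E P m C col [] = 1 := by
  unfold TT
  have h1 : ∀ π : (i : Fin C) → Perm (Fin (col i).vars.length),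
      (∏ i, ((Perm.sign (π i) : ℤ) : K)) * (([] : List ℕ).map fun u => Sfun E P m
        (∑ i, colContentL E (col i).labels (permVars (col i) (π i)) u)).prod = 1 := by
    intro π
    rw [List.map_nil, List.prod_nil, mul_one]
    refine Finset.prod_eq_one fun i _ => ?_
    haveI : Subsingleton (Fin (col i).vars.length) := by
      rw [h i, List.length_nil]; exact inferInstance
    rw [Subsingleton.elim (π i) 1, Perm.sign_one]; simp
  rw [Finset.sum_congr rfl fun π _ => h1 π, Finset.sum_const, Finset.card_univ, nsmul_eq_mul,
    mul_one]
  rw [Fintype.card_pi]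
  have : ∀ i : Fin C, Fintype.card (Perm (Fin (col i).vars.length)) = 1 := fun i => by
    rw [Fintype.card_perm, Fintype.card_fin, h i]; rfl
  simp [this]

/-- **The induction**: in the invariant regime, the label-major specification equals the closed
form, for any entry function `S` that is `α! · coeff_α` on words of length `m` with letters
`< Nv`. [folklore] -/
theorem specL_eq_TT (P : Point K) (m : ℕ) (S : List ℕ → K)
    (hS : ∀ w : List ℕ, w.length = m → (∀ v ∈ w, v < Nv) → S w = Sfun E P m (contentL E w)) :
    ∀ (U : List ℕ) (cs : List Column), Inv m Nv U cs → specL S U cs = TT E P m cs.length cs.get U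
  | [], cs, hI => by
    rw [specL]
    refine (TT_nil_of_empty E P m cs.get fun i => ?_).symm
    have hc := List.get_mem cs i
    have h1 : (cs.get i).labels = [] := List.eq_nil_iff_forall_not_mem.mpr
      fun l hl => by simpa using hI.sub _ hc l hl
    exact List.eq_nil_of_length_eq_zero (by rw [hI.len _ hc, h1]; rfl)
  | u :: U', cs, hI => by
    -- the activity pattern and the hypotheses of the one-label step
    let act : Fin cs.length → Bool := fun i => (cs.get i).active u
    have hmem : ∀ i, cs.get i ∈ cs := fun i => List.get_mem cs i
    have hne : ∀ i, act i = true → (cs.get i).vars ≠ [] := by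
      intro i h hv
      have h1 := labels_eq_cons_of_active (c := cs.get i) h
      have h2 := hI.len _ (hmem i)
      rw [hv, h1] at h2; simp at h2
    have hres : ∀ i j, u ∉ (redB (act i) (cs.get i) j).labels := fun i j =>
      not_mem_redB hI.uasc _ (hI.asc _ (hmem i)) (hI.sub _ (hmem i)) _ rfl j
    have hU' : u ∉ U' := fun h => lt_irrefl _ (List.rel_of_pairwise_cons hI.uasc h)
    -- left-hand side: the walk as a sum over choice tuples
    rw [specL, sum_walkL u cs act (fun _ => rfl) (fun s w cs' => s * S w * specL S U' cs'),
      TT_cons E P m cs.get u U' act (fun _ => rfl) hne hres hU']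
    refine Finset.sum_congr rfl fun js _ => ?_
    -- the residual columns satisfy the invariants for `U'`
    have hI' : Inv m Nv U' (List.ofFn fun i => redB (act i) (cs.get i) (js i)) := by
      refine ⟨?_, ?_, ?_, (List.pairwise_cons.mp hI.uasc).2, ?_, ?_⟩
      · intro c hc
        rw [List.mem_ofFn] at hc; obtain ⟨i, rfl⟩ := hc
        exact length_redB _ u _ rfl (hI.len _ (hmem i)) _ (js i).isLt
      · intro c hc
        rw [List.mem_ofFn] at hc; obtain ⟨i, rfl⟩ := hc
        exact pairwise_redB _ _ (hI.asc _ (hmem i)) _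
      · intro c hc l hl
        rw [List.mem_ofFn] at hc; obtain ⟨i, rfl⟩ := hc
        have hl' : l ∈ (cs.get i).labels := mem_labels_of_mem_redB _ _ _ _ hl
        rcases List.mem_cons.mp (hI.sub _ (hmem i) l hl') with rfl | h
        · exact absurd hl (hres i (js i))
        · exact h
      · intro c hc v hv
        rw [List.mem_ofFn] at hc; obtain ⟨i, rfl⟩ := hc
        exact hI.var _ (hmem i) v (mem_vars_of_mem_redB _ _ _ _ hv)
      · intro u' hu'
        have hne' : u' ≠ u := fun h => hU' (h ▸ hu')
        rw [countNat_flatMap_ofFn, ← hI.cnt u' (List.mem_cons_of_mem _ hu'), countNat_flatMap_get]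
        exact Finset.sum_congr rfl fun i _ => countNat_redB hne' _ _ rfl _
    -- the word has length `m`, letters `< Nv`, and the right content
    have hlenw : (wordB cs.get act fun i => (js i : ℕ)).length = m := by
      rw [length_wordB, ← hI.cnt u List.mem_cons_self, countNat_flatMap_get]
      refine Finset.sum_congr rfl fun i _ => ?_
      rw [countNat_labels_eq hI.uasc _ (hI.asc _ (hmem i)) (hI.sub _ (hmem i)) (act i) rfl]
    have hvarw : ∀ v ∈ wordB cs.get act (fun i => (js i : ℕ)), v < Nv := by
      intro v hv
      obtain ⟨i, hi⟩ := mem_wordB cs.get act js v hv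
      exact hI.var _ (hmem i) v hi
    rw [hS _ hlenw hvarw, contentL_wordB, specL_eq_TT P m S hS U' _ hI']
    -- reindex the residual columns
    congr 1
    have hget : (List.ofFn fun i => redB (act i) (cs.get i) (js i)).get =
        (fun i => redB (act i) (cs.get i) (js i)) ∘ Fin.cast List.length_ofFn := by
      funext i; rw [Function.comp_apply, List.get_ofFn]
    rw [hget, TT_congr]

end Induction

/-! ## §5 Assembly -/

section Assembly

variable [Fintype σ] [DecidableEq σ]

omit [Fintype σ] [DecidableEq σ] in
/-- A product over `List.range n` as a product over `Fin n`. [folklore] -/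
theorem prod_map_range {M : Type*} [CommMonoid M] (n : ℕ) (g : ℕ → M) :
    ((List.range n).map g).prod = ∏ j : Fin n, g j := by
  induction n with
  | zero => simp
  | succ n ih => rw [List.range_succ, List.map_append, List.prod_append, ih,
      Fin.prod_univ_castSucc]; simp

/-- **The label-major specification computes `evalC`.** For a list point all of whose terms have
`m` forms, a column-strict network with equal-length alternator/label lists, labels `< d`, every
label on `m` boxes and variables `< N_v`, and an entry function `S` agreeing with `α! · coeff_α` on
words of length `m` with letters `< N_v`: `specL S [0, …, d-1] N.cols = evalC P N`. [folklore] -/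
theorem specL_eq_evalC (P : Point K) (N : Network)
    (hP : ∀ t : Fin P.terms.length, (P.terms.get t).2.length = N.perLabel)
    (hlen : ∀ c ∈ N.cols, c.vars.length = c.labels.length)
    (hvar : ∀ c ∈ N.cols, ∀ i ∈ c.vars, i < Nv)
    (hlab : ∀ c ∈ N.cols, ∀ u ∈ c.labels, u < N.nlabels)
    (hcnt : ∀ u, u < N.nlabels → countNat u N.allLabels = N.perLabel)
    (hcs : N.columnStrict = true)
    (S : List ℕ → K)
    (hS : ∀ w : List ℕ, w.length = N.perLabel → (∀ v ∈ w, v < Nv) →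
      S w = Sfun E P N.perLabel (contentL E w)) :
    specL S (List.range N.nlabels) N.cols = evalC P N := by
  have hI : Inv N.perLabel Nv (List.range N.nlabels) N.cols := by
    refine ⟨hlen, fun c hc => ?_, fun c hc l hl => List.mem_range.mpr (hlab c hc l hl),
      List.pairwise_lt_range, hvar, fun u hu => hcnt u (List.mem_range.mp hu)⟩
    unfold Network.columnStrict at hcs
    exact pairwise_of_strictAsc _ ((List.all_eq_true.mp hcs) c hc)
  rw [specL_eq_TT E P N.perLabel S hS _ _ hI, evalC_eq_sum_S E P N hP hlen hvar hlab hcnt]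
  unfold TT sgnL
  refine Finset.sum_congr rfl fun π _ => ?_
  congr 1
  rw [prod_map_range]
  rfl

end Assembly

end TableauEval

end Literature.Computability.AlgebraicComplexity

end
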